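import Literature.NumberTheory.DiophantineApproximation.DilogLinearIndependence
import Literature.NumberTheory.DiophantineApproximation.DilogHermitePadeRationalSeries
import Literature.NumberTheory.DiophantineApproximation.DilogHermitePadeRationalArithmetic
import HarnessLib

/-!
# Linear independence of `1, Li₁(M/N), Li₂(M/N)` over `ℚ` for `N ≥ 10¹⁰ M⁴`

Topic `Literature/NumberTheory/DiophantineApproximation`. The rational-point case of
`DilogLinearIndependence.lean`: for all natural numbers `M ≥ 1` and `N ≥ 10¹⁰·M⁴` the three real
numbers `1`, `L₁ = ∑_{k≥1} (M/N)^k/k = log(N/(N−M))`, `L₂ = ∑_{k≥1} (M/N)^k/k² = Li₂(M/N)` are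
linearly independent over `ℚ` (`DilogPade.intRelation_trivial_rat`,
`one_polylogOne_polylogTwo_linearIndependent_rat`). A (weak, `N ≫ M⁴`) special case of the theorems
of Nikišin (1979), Hata (1990) and David–Hirata-Kohno–Kawashima 2020, Thm 2.1 on polylogarithms at
rational points.
-- TODO(general form): all weights and the thresholds of [DavidHirataKohnoKawashima2020, Thm 2.1].

## Proof

Identical to the integer case with `x = M/N`: the forms `M^n S_n(M/N) = a^ℚ_n L₂ + b^ℚ_n L₁ + c^ℚ_n`
(`DilogHermitePadeRationalSeries.lean`, coefficients `DilogPade.formAQ/formBQ/formCQ` with the same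
common denominator `D_n = lcm(1..3n)·lcm(1..n)²` and the same size `≤ 10 n³ 2^{7n} N^n`,
`DilogHermitePadeRationalArithmetic.lean`), the two-sided bounds of `DilogHermitePadeBounds.lean`
at `x = M/N ≤ 1/2`, and the transference lemma with
`A₂ = 2 log N − 3 log M − 5 − 3δ`, `A₁ = 2 log N − 2 log M + 6 log(3/2) + 2δ`,
`B = log N + 7 log 2 + 5 + 3δ`; the gap `A₁ + B < 2A₂` reads
`6 log(3/2) + 7 log 2 + 15 + 11δ + 4 log M < log N`, and `log(10¹⁰ M⁴) ≥ 33 log 2 + 4 log M`.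

References: E. M. Nikišin, Mat. Sb. 109 (1979); M. Hata, J. Math. Pures Appl. 69 (1990);
S. David, N. Hirata-Kohno, M. Kawashima, Moscow J. Comb. Number Th. 9 (2020), Thm 2.1.
-/

noncomputable section

open Finset Filter Real

namespace Literature.NumberTheory.DiophantineApproximation

namespace DilogPade

open _root_.Filter _root_.Topology

/-! ## The weight-one value at a rational point and its irrationality -/

/-- `L₁(M/N) = ∑_{k≥1} (M/N)^k/k = log(N/(N−M))` for `1 ≤ M < N`. [folklore] -/
theorem polylogSeries_one_eq_log_rat {M N : ℕ} (hM : 1 ≤ M) (hMN : M < N) :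
    polylogSeries 1 ((M : ℝ) / N) = Real.log ((N : ℝ) / ((N : ℝ) - M)) := by
  have hM' : (1 : ℝ) ≤ M := by exact_mod_cast hM
  have hMN' : (M : ℝ) < N := by exact_mod_cast hMN
  have hNpos : (0 : ℝ) < N := by linarith
  have hx : |(M : ℝ) / N| < 1 := by
    rw [abs_of_nonneg (by positivity), div_lt_one hNpos]; exact hMN'
  have h := (Real.hasSum_pow_div_log_of_abs_lt_one hx).tsum_eq
  rw [polylogSeries]
  simp only [pow_one]
  rw [h, ← Real.log_inv]
  congr 1
  rw [one_sub_div hNpos.ne', inv_div]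

/-- `L₁(M/N) = log(N/(N−M))` is irrational for `1 ≤ M < N` (Hermite–Lindemann, through the tree's
`irrational_log_ratCast`). [folklore] -/
theorem irrational_polylogSeries_one_rat {M N : ℕ} (hM : 1 ≤ M) (hMN : M < N) :
    Irrational (polylogSeries 1 ((M : ℝ) / N)) := by
  rw [polylogSeries_one_eq_log_rat hM hMN]
  have hM' : (1 : ℚ) ≤ M := by exact_mod_cast hM
  have hMN' : (M : ℚ) < N := by exact_mod_cast hMN
  have hq : (0 : ℚ) < (N : ℚ) / ((N : ℚ) - M) := div_pos (by linarith) (by linarith)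
  have hq1 : (N : ℚ) / ((N : ℚ) - M) ≠ 1 := by
    rw [Ne, div_eq_one_iff_eq (by linarith)]; linarith
  have h := Literature.Barriers.KontsevichZagierPeriods.irrational_log_ratCast _ hq hq1
  have hcast : (((N : ℚ) / ((N : ℚ) - M) : ℚ) : ℝ) = (N : ℝ) / ((N : ℝ) - M) := by push_cast; ring
  rwa [hcast] at h

/-! ## The main theorem at rational points -/

/-- **No integer relation** `a + b L₁ + c L₂ = 0` among `1, L₁ = Li₁(M/N), L₂ = Li₂(M/N)` for
`M ≥ 1`, `N ≥ 10¹⁰ M⁴`, except the trivial one. [cite: DavidHirataKohnoKawashima2020, Thm 2.1] -/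
theorem intRelation_trivial_rat (M N : ℕ) (hM : 1 ≤ M) (hN : 10 ^ 10 * M ^ 4 ≤ N) (a b c : ℤ)
    (h : (a : ℝ) + b * polylogSeries 1 ((M : ℝ) / N) + c * polylogSeries 2 ((M : ℝ) / N) = 0) :
    a = 0 ∧ b = 0 ∧ c = 0 := by
  have hM4 : 1 ≤ M ^ 4 := Nat.one_le_pow _ _ hM
  have hMM4 : M ≤ M ^ 4 := by
    calc M = M ^ 1 := (pow_one M).symm
      _ ≤ M ^ 4 := Nat.pow_le_pow_right hM (by norm_num)
  have h2M : 2 * M ≤ N := le_trans (by nlinarith) hN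
  have hMN : M < N := by omega
  have hMleN : M ≤ N := hMN.le
  have hN1 : 1 ≤ N := le_trans hM hMleN
  have hMr : (1 : ℝ) ≤ M := by exact_mod_cast hM
  have hMpos : (0 : ℝ) < M := by linarith
  have h2Mr : 2 * (M : ℝ) ≤ N := by exact_mod_cast h2M
  have hNpos : (0 : ℝ) < N := by linarith
  have hx0 : (0 : ℝ) < (M : ℝ) / N := by positivity
  have hx1 : (M : ℝ) / N ≤ 1 / 2 := by
    rw [div_le_iff₀ hNpos]; linarith
  have hx1' : (M : ℝ) / N < 1 := by linarith
  have hirr := irrational_polylogSeries_one_rat hM hMN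
  set L₁ := polylogSeries 1 ((M : ℝ) / N) with hL₁
  set L₂ := polylogSeries 2 ((M : ℝ) / N) with hL₂
  by_cases hc : c = 0
  · -- weight one
    subst hc
    have h' : (a : ℝ) + b * L₁ = 0 := by simpa using h
    by_cases hb : b = 0
    · subst hb
      have ha : (a : ℝ) = 0 := by simpa using h'
      exact ⟨by exact_mod_cast ha, rfl, rfl⟩
    · exfalso
      have hb' : (b : ℝ) ≠ 0 := by exact_mod_cast hb
      refine hirr.ne_rat ((-a : ℚ) / b) ?_
      push_cast
      field_simp
      linarith
  · exfalso
    -- the integer forms `ℓ_n = D_n M^n S_n = r_n L₂ + q_n L₁ + p_n`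
    choose q hq using fun n => isInt_denom_mul_formBQ n N M
    choose p hp using fun n => isInt_denom_mul_formCQ n N M
    set r : ℕ → ℤ := fun n => (denom n : ℤ) * formAQ n N M with hr
    have hqR : ∀ n, (q n : ℝ) = (denom n : ℝ) * ((formBQ n N M : ℚ) : ℝ) := fun n => by
      have h1 := congrArg (fun t : ℚ => (t : ℝ)) (hq n)
      push_cast at h1
      linarith
    have hpR : ∀ n, (p n : ℝ) = (denom n : ℝ) * ((formCQ n N M : ℚ) : ℝ) := fun n => by
      have h1 := congrArg (fun t : ℚ => (t : ℝ)) (hp n)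
      push_cast at h1
      linarith
    have hrR : ∀ n, (r n : ℝ) = (denom n : ℝ) * (formAQ n N M : ℝ) := fun n => by
      simp only [hr]; push_cast; ring
    have hval : ∀ n, (denom n : ℝ) * ((M : ℝ) ^ n * form n ((M : ℝ) / N)) =
        r n * L₂ + q n * L₁ + p n := by
      intro n
      rw [pow_mul_form_eq_rat hM h2M, hrR, hqR, hpR]
      ring
    have hPQ : ∀ n, ((c * p n - a * r n : ℤ) : ℝ) + ((c * q n - b * r n : ℤ) : ℝ) * L₁ =
        c * ((denom n : ℝ) * ((M : ℝ) ^ n * form n ((M : ℝ) / N))) := by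
      intro n
      rw [hval n]
      push_cast
      linear_combination (-(r n : ℝ)) * h
    have hDform_pos : ∀ n, 0 < (denom n : ℝ) * ((M : ℝ) ^ n * form n ((M : ℝ) / N)) := fun n =>
      mul_pos (by exact_mod_cast denom_pos n) (mul_pos (pow_pos hMpos n) (form_pos n hx0 hx1'))
    have hcabs : (1 : ℝ) ≤ |(c : ℝ)| := by exact_mod_cast Int.one_le_abs hc
    -- the constants (kept opaque, with their defining equations, for `linarith`)
    obtain ⟨l2, hl2def⟩ : ∃ l2 : ℝ, l2 = Real.log 2 := ⟨_, rfl⟩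
    obtain ⟨L, hLdef⟩ : ∃ L : ℝ, L = Real.log N := ⟨_, rfl⟩
    obtain ⟨lM, hlMdef⟩ : ∃ lM : ℝ, lM = Real.log M := ⟨_, rfl⟩
    obtain ⟨κ, hκdef⟩ : ∃ κ : ℝ, κ = 6 * Real.log (3 / 2) := ⟨_, rfl⟩
    obtain ⟨δ, hδdef⟩ : ∃ δ : ℝ, δ = 1 / 40 := ⟨_, rfl⟩
    have hδ : (0 : ℝ) < δ := by rw [hδdef]; norm_num
    have hδ2 : (0 : ℝ) < 2 * δ := by linarith
    have hl2 : 0.6931471803 < l2 := by rw [hl2def]; exact Real.log_two_gt_d9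
    have hlM0 : 0 ≤ lM := by rw [hlMdef]; exact Real.log_nonneg hMr
    have hκ0 : 0 ≤ κ := by
      rw [hκdef]; exact mul_nonneg (by norm_num) (Real.log_nonneg (by norm_num))
    have hκ : κ < 18 / 5 * l2 := by
      have h1 : Real.log (((3 : ℝ) / 2) ^ 5) < Real.log ((2 : ℝ) ^ 3) :=
        Real.log_lt_log (by positivity) (by norm_num)
      rw [Real.log_pow, Real.log_pow] at h1
      push_cast at h1
      rw [hκdef, hl2def]
      linarith
    have hL : 33 * l2 + 4 * lM ≤ L := by
      have h2 : ((2 : ℝ) ^ 33) * (M : ℝ) ^ 4 ≤ N := by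
        have : (2 : ℕ) ^ 33 * M ^ 4 ≤ N := le_trans (Nat.mul_le_mul_right _ (by norm_num)) hN
        exact_mod_cast this
      have := Real.log_le_log (by positivity) h2
      rw [Real.log_mul (by positivity) (by positivity), Real.log_pow, Real.log_pow] at this
      push_cast at this
      rw [hl2def, hlMdef, hLdef]
      exact this
    have hLpos : 0 < L := by linarith
    -- powers as exponentials in the opaque constants
    have hxlog : Real.log ((M : ℝ) / N) = lM - L := by
      rw [Real.log_div hMpos.ne' hNpos.ne', hlMdef, hLdef]
    have hxpow : ∀ m : ℕ, ((M : ℝ) / N) ^ m = Real.exp (-((L - lM) * m)) := fun m => by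
      rw [pow_eq_exp_log_mul hx0 m, hxlog]; ring_nf
    have hNpow : ∀ m : ℕ, (N : ℝ) ^ m = Real.exp (L * m) := fun m => by
      rw [hLdef]; exact pow_eq_exp_log_mul hNpos m
    have hMpow : ∀ m : ℕ, (M : ℝ) ^ m = Real.exp (lM * m) := fun m => by
      rw [hlMdef]; exact pow_eq_exp_log_mul hMpos m
    have h2pow : ∀ m : ℕ, (2 : ℝ) ^ m = Real.exp (l2 * m) := fun m => by
      rw [hl2def]; exact pow_eq_exp_log_mul two_pos m
    -- transference with `A₁ = 2L − 2lM + κ + 2δ`, `A₂ = 2L − 3lM − 5 − 3δ`, `B = L + 7 log 2 + 5 + 3δ`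
    refine no_integer_forms_of_irrational hirr (A₁ := 2 * L - 2 * lM + κ + 2 * δ)
      (A₂ := 2 * L - 3 * lM - 5 - 3 * δ) (B := L + 7 * l2 + 5 + 3 * δ) ?_ ?_ ?_ ?_
      (fun n => c * p n - a * r n) (fun n => c * q n - b * r n) ?_ ?_ ?_
    · linarith
    · linarith
    · linarith
    · linarith
    · -- lower bound
      have hfac' := eventually_exp_le_factorial_ratio hδ
      rw [← hκdef] at hfac'
      filter_upwards [hfac', eventually_const_le_mul (L - lM) hδ] with n hfac hLn
      show Real.exp (-((2 * L - 2 * lM + κ + 2 * δ) * n)) ≤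
        |((c * p n - a * r n : ℤ) : ℝ) + ((c * q n - b * r n : ℤ) : ℝ) * L₁|
      rw [hPQ n, abs_mul, abs_of_pos (hDform_pos n)]
      calc Real.exp (-((2 * L - 2 * lM + κ + 2 * δ) * n))
          ≤ Real.exp (-((κ + δ) * n)) * Real.exp (-((L - lM) * ((2 * n + 1 : ℕ) : ℝ))) := by
            rw [← Real.exp_add]
            apply Real.exp_le_exp.2
            push_cast
            linear_combination hLn
        _ ≤ ((2 * n).factorial : ℝ) ^ 3 / (((3 * n + 1).factorial : ℝ) ^ 2) *
              ((M : ℝ) / N) ^ (2 * n + 1) := by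
            rw [hxpow]
            exact mul_le_mul_of_nonneg_right hfac (Real.exp_pos _).le
        _ ≤ form n ((M : ℝ) / N) := form_ge n hx0.le hx1'
        _ ≤ |(c : ℝ)| * ((denom n : ℝ) * ((M : ℝ) ^ n * form n ((M : ℝ) / N))) := by
            have hf := (form_pos n hx0 hx1').le
            have h1 : (1 : ℝ) ≤ |(c : ℝ)| * ((denom n : ℝ) * (M : ℝ) ^ n) :=
              one_le_mul_of_one_le_of_one_le hcabs
                (one_le_mul_of_one_le_of_one_le (by exact_mod_cast denom_pos n)
                  (one_le_pow₀ hMr))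
            calc form n ((M : ℝ) / N) = 1 * form n ((M : ℝ) / N) := (one_mul _).symm
              _ ≤ (|(c : ℝ)| * ((denom n : ℝ) * (M : ℝ) ^ n)) * form n ((M : ℝ) / N) :=
                  mul_le_mul_of_nonneg_right h1 hf
              _ = _ := by ring
    · -- upper bound
      filter_upwards [eventually_denom_le_exp hδ2, eventually_const_le_exp_mul |(c : ℝ)| hδ,
        eventually_ge_atTop 1] with n hD hcδ hn1
      show |((c * p n - a * r n : ℤ) : ℝ) + ((c * q n - b * r n : ℤ) : ℝ) * L₁| ≤
        Real.exp (-((2 * L - 3 * lM - 5 - 3 * δ) * n))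
      rw [hPQ n, abs_mul, abs_of_pos (hDform_pos n)]
      have hform_le : form n ((M : ℝ) / N) ≤ ((M : ℝ) / N) ^ (2 * n) := form_le hn1 hx0.le hx1
      calc |(c : ℝ)| * ((denom n : ℝ) * ((M : ℝ) ^ n * form n ((M : ℝ) / N)))
          ≤ Real.exp (δ * n) * (Real.exp ((5 + 2 * δ) * n) *
              (Real.exp (lM * n) * Real.exp (-((L - lM) * ((2 * n : ℕ) : ℝ))))) := by
            refine mul_le_mul hcδ ?_ (hDform_pos n).le (Real.exp_pos _).le
            refine mul_le_mul hD ?_ (mul_pos (pow_pos hMpos n) (form_pos n hx0 hx1')).le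
              (Real.exp_pos _).le
            rw [← hxpow, ← hMpow]
            exact mul_le_mul_of_nonneg_left hform_le (by positivity)
        _ = Real.exp (-((2 * L - 3 * lM - 5 - 3 * δ) * n)) := by
            rw [← Real.exp_add, ← Real.exp_add, ← Real.exp_add]
            congr 1
            push_cast
            ring
    · -- coefficients
      filter_upwards [eventually_denom_le_exp hδ2,
        eventually_const_mul_pow_le_exp_mul ((|(b : ℝ)| + |(c : ℝ)|) * 10) 3 hδ,
        eventually_ge_atTop 1] with n hD hpoly hn1
      show |((c * q n - b * r n : ℤ) : ℝ)| ≤ Real.exp ((L + 7 * l2 + 5 + 3 * δ) * n)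
      set Mb : ℝ := 10 * (n : ℝ) ^ 3 * 2 ^ (7 * n) * (N : ℝ) ^ n with hMbdef
      have hD0 : (0 : ℝ) ≤ denom n := by positivity
      have hq_le : |(q n : ℝ)| ≤ (denom n : ℝ) * Mb := by
        rw [hqR, abs_mul, abs_of_nonneg hD0]
        exact mul_le_mul_of_nonneg_left (abs_formBQ_le hn1 hM hMleN) hD0
      have hr_le : |(r n : ℝ)| ≤ (denom n : ℝ) * Mb := by
        rw [hrR, abs_mul, abs_of_nonneg hD0]
        exact mul_le_mul_of_nonneg_left (abs_formAQ_le hn1 hM hMleN) hD0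
      calc |((c * q n - b * r n : ℤ) : ℝ)|
          = |(c : ℝ) * q n - b * r n| := by push_cast; ring_nf
        _ ≤ |(c : ℝ) * q n| + |(b : ℝ) * r n| := abs_sub _ _
        _ = |(c : ℝ)| * |(q n : ℝ)| + |(b : ℝ)| * |(r n : ℝ)| := by rw [abs_mul, abs_mul]
        _ ≤ |(c : ℝ)| * ((denom n : ℝ) * Mb) + |(b : ℝ)| * ((denom n : ℝ) * Mb) :=
            add_le_add (mul_le_mul_of_nonneg_left hq_le (abs_nonneg _))
              (mul_le_mul_of_nonneg_left hr_le (abs_nonneg _))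
        _ = ((|(b : ℝ)| + |(c : ℝ)|) * 10 * (n : ℝ) ^ 3) * (denom n : ℝ) *
              ((2 : ℝ) ^ (7 * n) * (N : ℝ) ^ n) := by
            simp only [hMbdef]; ring
        _ ≤ Real.exp (δ * n) * Real.exp ((5 + 2 * δ) * n) *
              ((2 : ℝ) ^ (7 * n) * (N : ℝ) ^ n) := by
            refine mul_le_mul_of_nonneg_right ?_ (by positivity)
            exact mul_le_mul hpoly hD hD0 (Real.exp_pos _).le
        _ = Real.exp ((L + 7 * l2 + 5 + 3 * δ) * n) := by
            rw [h2pow, hNpow, ← Real.exp_add, ← Real.exp_add, ← Real.exp_add]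
            congr 1
            push_cast
            ring

end DilogPade

open DilogPade in
/-- **Linear independence of `1, Li₁(M/N), Li₂(M/N)` over `ℚ` for `M ≥ 1`, `N ≥ 10¹⁰ M⁴`**: with
`L_s = ∑_{k≥1} (M/N)^k/k^s` (`DilogPade.polylogSeries s (M/N)`; `L₁ = log(N/(N−M))`,
`L₂ = Li₂(M/N)`), every rational relation `a + b L₁ + c L₂ = 0` is trivial.
[cite: DavidHirataKohnoKawashima2020, Thm 2.1] -/
theorem one_polylogOne_polylogTwo_linearIndependent_rat (M N : ℕ) (hM : 1 ≤ M)
    (hN : 10 ^ 10 * M ^ 4 ≤ N) (a b c : ℚ)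
    (h : (a : ℝ) + b * DilogPade.polylogSeries 1 ((M : ℝ) / N) +
      c * DilogPade.polylogSeries 2 ((M : ℝ) / N) = 0) :
    a = 0 ∧ b = 0 ∧ c = 0 := by
  -- clear denominators with `d = a.den · b.den · c.den`
  set d : ℕ := a.den * b.den * c.den with hd
  have hd0 : d ≠ 0 := by simp [hd]
  have ha : (((a.num * b.den * c.den : ℤ) : ℚ) : ℝ) = (d : ℝ) * a := by
    have h1 : ((a.num * b.den * c.den : ℤ) : ℚ) = (d : ℚ) * a := by
      simp only [hd]; push_cast; rw [← Rat.mul_den_eq_num a]; ring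
    rw [h1]; push_cast; ring
  have hb : (((b.num * a.den * c.den : ℤ) : ℚ) : ℝ) = (d : ℝ) * b := by
    have h1 : ((b.num * a.den * c.den : ℤ) : ℚ) = (d : ℚ) * b := by
      simp only [hd]; push_cast; rw [← Rat.mul_den_eq_num b]; ring
    rw [h1]; push_cast; ring
  have hc : (((c.num * a.den * b.den : ℤ) : ℚ) : ℝ) = (d : ℝ) * c := by
    have h1 : ((c.num * a.den * b.den : ℤ) : ℚ) = (d : ℚ) * c := by
      simp only [hd]; push_cast; rw [← Rat.mul_den_eq_num c]; ring
    rw [h1]; push_cast; ring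
  have h' : ((a.num * b.den * c.den : ℤ) : ℝ) +
      (b.num * a.den * c.den : ℤ) * DilogPade.polylogSeries 1 ((M : ℝ) / N) +
      (c.num * a.den * b.den : ℤ) * DilogPade.polylogSeries 2 ((M : ℝ) / N) = 0 := by
    have ea : ((a.num * b.den * c.den : ℤ) : ℝ) = (d : ℝ) * a := by exact_mod_cast ha
    have eb : ((b.num * a.den * c.den : ℤ) : ℝ) = (d : ℝ) * b := by exact_mod_cast hb
    have ec : ((c.num * a.den * b.den : ℤ) : ℝ) = (d : ℝ) * c := by exact_mod_cast hc
    rw [ea, eb, ec]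
    linear_combination (d : ℝ) * h
  obtain ⟨h1, h2, h3⟩ := intRelation_trivial_rat M N hM hN _ _ _ h'
  have hbd : (b.den : ℤ) ≠ 0 := by exact_mod_cast b.den_nz
  have had : (a.den : ℤ) ≠ 0 := by exact_mod_cast a.den_nz
  have hcd : (c.den : ℤ) ≠ 0 := by exact_mod_cast c.den_nz
  refine ⟨?_, ?_, ?_⟩
  · have : a.num = 0 := by
      rcases mul_eq_zero.1 h1 with h | h
      · rcases mul_eq_zero.1 h with h | h
        · exact h
        · exact absurd h hbd
      · exact absurd h hcd
    exact Rat.zero_of_num_zero this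
  · have : b.num = 0 := by
      rcases mul_eq_zero.1 h2 with h | h
      · rcases mul_eq_zero.1 h with h | h
        · exact h
        · exact absurd h had
      · exact absurd h hcd
    exact Rat.zero_of_num_zero this
  · have : c.num = 0 := by
      rcases mul_eq_zero.1 h3 with h | h
      · rcases mul_eq_zero.1 h with h | h
        · exact h
        · exact absurd h had
      · exact absurd h hbd
    exact Rat.zero_of_num_zero this

end Literature.NumberTheory.DiophantineApproximation
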